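import Literature.Analysis.FluidPDE.NormalisedPressureLpClass
import Literature.Claims.NS.Wu2026
import HarnessLib

/-!
# C177 `Wu2026` — toward `Step_341` (§3.3): the bilinear difference identity of the canonical
# pressure with three exponents, and small `L^p` bookkeeping

Seat `ns-in-wu-341` (D-0154 (2) INPUTS, director-ns req136; A3 Wu 2026, KEY `Step_341`), filed in the
salvage namespace `…Theorems.Wu2026Salvage` (theorems only, standard axioms, no definition, no named fact).

The weak-type bound `v ∈ L^{9/2,∞} ⇒ p̃[v] ∈ L^{9/4,∞}` of Wu 2026 (3.41) (`p̃ = normalisedPressure`,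
the canonical Riesz-transform pressure) is proved in `SoloSalvageWu2026PressureWeak` by real
interpolation (height splitting `v = v𝟙_{|v|≤s} + v𝟙_{|v|>s}`) through the bilinear structure of
the quadratic map `w ↦ p̃[w]`. The splitting needs the tree's difference identity
`p̃[a] − p̃[b] = −⟨a−b, a+b⟩/3 + P`, `‖P‖_p ≤ K_p‖|a−b||a+b|‖_p` (`exists_normalisedPressure_sub_ae_eq`,
`NormalisedPressureLpClass`) with the product measured at an exponent `p` (`= 2 < 9/4`) DIFFERENT
from the Lebesgue exponents of `|a|²`, `|b|²` (`= 3 > 9/4`); the tree states it with one exponent.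

* `exists_normalisedPressure_sub_ae_eq₃` — the identity with three exponents `p_a`, `p_b`, `p`
  (verbatim re-run of the tree's proof: `p_a`, `p_b` serve only the a.e. existence of the two
  principal values and the integrability of the truncations, `p` only the bilinear principal value
  `exists_bilinear_pv`);
* `eLpNorm_rpow_toReal_eq_lintegral`, `enorm_norm_sq_rpow`, `setOf_lt_norm_subset_setOf_ofReal_le_enorm`
  — bookkeeping used by the Chebyshev steps of the interpolation.

WHAT THIS IS NOT: not a claim about NS regularity or blow-up; not a claim about any author beyond the
typed locator.
-/

noncomputable section

set_option linter.dupNamespace false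

open MeasureTheory Set Function Filter Topology Metric
open scoped ENNReal NNReal RealInnerProductSpace

namespace Summit.NavierStokesRegularity.NavierStokesRegularity.Theorems.Wu2026Salvage

open Literature.Claims.NS.Wu2026 Literature.Analysis.FluidPDE Literature.Analysis.FunctionSpaces

-- nested operator types in the imported pressure files
set_option maxSynthPendingDepth 3

/-! ### The bilinear difference identity with three exponents -/

/-- **The difference of two normalised pressures, three exponents**: for `1 < p_a, p_b, p < ∞`,
measurable `a`, `b` with `|a|² ∈ L^{p_a}`, `|b|² ∈ L^{p_b}` and `|a − b||a + b| ∈ L^p`, a.e.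
`p̃[a] − p̃[b] = −⟨a−b, a+b⟩/3 + P` with `P` measurable and `‖P‖_p ≤ K_p ‖|a−b||a+b|‖_p`, `K_p = (27/2)A_p`
(the tree's `exists_normalisedPressure_sub_ae_eq` is `p_a = p_b = p`; its proof uses `p_a`, `p_b` only
for the a.e. existence of the two principal values and the integrability of the truncations, and
`p` only through the bilinear principal value `exists_bilinear_pv`).
[cite: Stein1971, Ch. II §4.2 Thm 3 and §4.5 Thm 4] -/
theorem exists_normalisedPressure_sub_ae_eq₃ {pa pb p : ℝ≥0∞} (hpa1 : 1 < pa) (hpa2 : pa < ⊤)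
    (hpb1 : 1 < pb) (hpb2 : pb < ⊤) (hp1 : 1 < p) (hp2 : p < ⊤) :
    ∃ K : ℝ≥0∞, K ≠ ⊤ ∧ ∀ a b : E3 → E3, AEStronglyMeasurable a volume →
      AEStronglyMeasurable b volume → MemLp (fun y => ‖a y‖ ^ 2) pa volume →
      MemLp (fun y => ‖b y‖ ^ 2) pb volume →
      MemLp (fun y => ‖a y - b y‖ * ‖a y + b y‖) p volume →
      ∃ P : E3 → ℝ, AEStronglyMeasurable P volume ∧
        ((fun x => normalisedPressure a x - normalisedPressure b x) =ᵐ[volume]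
          fun x => -(3⁻¹ : ℝ) * ⟪a x - b x, a x + b x⟫ + P x) ∧
        eLpNorm P p volume ≤ K * eLpNorm (fun y => ‖a y - b y‖ * ‖a y + b y‖) p volume := by
  obtain ⟨A, hAt, hA⟩ := exists_eLpNorm_rieszTrunc_le (p := p) hp1 hp2
  set K : ℝ≥0∞ := 27 * 2⁻¹ * A with hK
  have hKt : K ≠ ⊤ := by simp only [hK]; finiteness
  refine ⟨K, hKt, fun a b ha hb ha2 hb2 hcs => ?_⟩
  -- conjugate exponents (integrability of the truncations)
  set qa : ℝ≥0∞ := ENNReal.conjExponent pa with hqa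
  haveI hpqa : ENNReal.HolderConjugate pa qa := ENNReal.HolderConjugate.conjExponent hpa1.le
  have hqa1 : 1 < qa := (ENNReal.HolderConjugate.lt_top_iff_one_lt pa qa).1 hpa2
  have hqat : qa ≠ ⊤ := (ENNReal.HolderConjugate.ne_top_iff_ne_one qa pa).2 (ne_of_gt hpa1)
  set qb : ℝ≥0∞ := ENNReal.conjExponent pb with hqb
  haveI hpqb : ENNReal.HolderConjugate pb qb := ENNReal.HolderConjugate.conjExponent hpb1.le
  have hqb1 : 1 < qb := (ENNReal.HolderConjugate.lt_top_iff_one_lt pb qb).1 hpb2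
  have hqbt : qb ≠ ⊤ := (ENNReal.HolderConjugate.ne_top_iff_ne_one qb pb).2 (ne_of_gt hpb1)
  -- the two fields `c = a - b`, `s = a + b`
  set c : E3 → E3 := fun y => a y - b y with hc
  set s : E3 → E3 := fun y => a y + b y with hs
  have hcm : AEStronglyMeasurable c volume := ha.sub hb
  have hsm : AEStronglyMeasurable s volume := ha.add hb
  -- the bilinear principal value and the two quadratic ones
  obtain ⟨P, hPm, hP, hPb⟩ := exists_bilinear_pv (f := c) (g := s) hp1 hp2 hA hcm hsm hcs
  have hPVa := ae_exists_hasPressurePV hpa1 hpa2 ha ha2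
  have hPVb := ae_exists_hasPressurePV hpb1 hpb2 hb hb2
  refine ⟨P, hPm, ?_, hPb⟩
  filter_upwards [hPVa, hPVb, hP] with x hxa hxb hxP
  obtain ⟨La, hLa⟩ := hxa
  obtain ⟨Lb, hLb⟩ := hxb
  -- the truncations of the difference, for `ε > 0`
  have htrunc : ∀ ε : ℝ, 0 < ε →
      truncatedPressureIntegral a x ε - truncatedPressureIntegral b x ε =
        ∫ y in (closedBall x ε)ᶜ, pressureForm (x - y) (c y) (s y) := by
    intro ε hε
    have hIa := integrableOn_pressureKernel_of_memLp hqa1 hqat ha ha2 x hε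
    have hIb := integrableOn_pressureKernel_of_memLp hqb1 hqbt hb hb2 x hε
    rw [truncatedPressureIntegral_sub_eq hIa hIb]
    rfl
  -- pass to the limit `ε → 0⁺`
  have hlim : Tendsto (fun ε => truncatedPressureIntegral a x ε - truncatedPressureIntegral b x ε)
      (𝓝[>] 0) (𝓝 (P x)) := by
    refine hxP.congr' ?_
    filter_upwards [self_mem_nhdsWithin] with ε hε
    exact (htrunc ε hε).symm
  have hlim' : Tendsto (fun ε => truncatedPressureIntegral a x ε - truncatedPressureIntegral b x ε)
      (𝓝[>] 0) (𝓝 (La - Lb)) := hLa.2.sub hLb.2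
  have hLL : La - Lb = P x := tendsto_nhds_unique hlim' hlim
  rw [normalisedPressure_sub_eq hLa hLb, hLL,
    Literature.Analysis.FluidPDE.norm_sq_sub_norm_sq_eq_inner]
  ring

/-! ### Small `L^p` bookkeeping -/

/-- `‖f‖_p^p = ∫ ‖f‖ₑ^p` for `0 < p < ∞`. [folklore] -/
theorem eLpNorm_rpow_toReal_eq_lintegral {α : Type*} [MeasurableSpace α] {μ : Measure α}
    {F : Type*} [NormedAddCommGroup F] (f : α → F) {p : ℝ≥0∞} (hp0 : p ≠ 0) (hpt : p ≠ ⊤) :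
    eLpNorm f p μ ^ p.toReal = ∫⁻ x, ‖f x‖ₑ ^ p.toReal ∂μ := by
  rw [eLpNorm_eq_eLpNorm' hp0 hpt,
    ← lintegral_rpow_enorm_eq_rpow_eLpNorm' (ENNReal.toReal_pos hp0 hpt)]

/-- `‖(‖w‖²)‖ₑ^r = ‖w‖ₑ^{2r}`. [folklore] -/
theorem enorm_norm_sq_rpow {F : Type*} [NormedAddCommGroup F] (w : F) (r : ℝ) :
    ‖(‖w‖ ^ 2)‖ₑ ^ r = ‖w‖ₑ ^ (2 * r) := by
  rw [Real.enorm_eq_ofReal (sq_nonneg _), ENNReal.ofReal_pow (norm_nonneg _), ofReal_norm,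
    ← ENNReal.rpow_natCast, ← ENNReal.rpow_mul]
  norm_num

/-- The Chebyshev superlevel set at a real height contains the real superlevel set. [folklore] -/
theorem setOf_lt_norm_subset_setOf_ofReal_le_enorm {α : Type*} {F : Type*} [NormedAddCommGroup F]
    (g : α → F) (r : ℝ) : {x | r < ‖g x‖} ⊆ {x | ENNReal.ofReal r ≤ ‖g x‖ₑ} := fun x hx => by
  simp only [mem_setOf_eq] at hx ⊢
  rw [← ofReal_norm]
  exact ENNReal.ofReal_le_ofReal hx.le

end Summit.NavierStokesRegularity.NavierStokesRegularity.Theorems.Wu2026Salvage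

end

-- WHAT THIS IS NOT: not a claim about NS regularity or blow-up; not a claim about any author beyond the typed locator.
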